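import Literature.Analysis.Pluripotential.NonPluripolarMongeAmpereMass
import Literature.Analysis.Complex.FanCrossing
import HarnessLib

/-!
# `C²` functions with non-negative Laplacian are subharmonic (Hörmander, Thm. 1.6.3, smooth case)

Topic `Literature/Analysis/Pluripotential`.  The tree's subharmonic functions are defined by the
sub-mean-value inequality over circles (`Literature.Analysis.Pluripotential.IsSubharmonicOn`,
`Plurisubharmonic.lean`, Hörmander Def. 1.6.1 in the form of Thm. 1.6.3 (ii)), and `LeviForm.lean`
proves the EASY half of the smooth case of Hörmander's Thm. 1.6.3 — sub-mean-value ⇒ `Δu ≥ 0`.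
This file proves the other half, for a `C²` function `u : ℂ → ℝ`:

  **`Δu ≥ 0` on the closed disc `D̄(c, R)` ⇒ `u(c) ≤ (2π)⁻¹ ∫₀^{2π} u(c + ρ e^{iθ}) dθ` for
  `0 < ρ ≤ R`** (`le_circleAverage_of_laplacian_nonneg`),

whence `IsSubharmonicOn u U` for `u ∈ C²(ℂ)` with `Δu ≥ 0` on an open `U`
(`isSubharmonicOn_coe_of_laplacian_nonneg`).  Here `Δu(z) = D²u(z)(1,1) + D²u(z)(i,i)` is written
with Mathlib's iterated Fréchet derivative `fderiv ℝ (fderiv ℝ u)`.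

Proof (the classical monotonicity of circle means, arranged so that only one-variable calculus
and Fubini for continuous functions on rectangles are used — no Green formula on discs, which
Mathlib lacks).  Put `g(r, θ) = u(c + r e^{iθ})`, `e = e^{iθ}`.  One-variable chain rules give
`∂ᵣ(Du(re)) = Du(e) + r D²u(e, e)` along rays and `∂_θ(Du(i r e)) = r² D²u(ie, ie) - r Du(e)`
along circles; the second integrates to `0` over `θ ∈ [0, 2π]` (periodicity), the first over
`r ∈ [δ, ρ]` to `Φ(ρ) - Φ(δ)` with `Φ(r) = ∫₀^{2π} Du_{c + re}(r e) dθ` (`= r · d/dr ∫ g`).  Adding,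
the first-order terms cancel and `D²u(e,e) + D²u(ie,ie) = Δu` (rotation invariance of the
Laplacian, `bilin_apply_add_bilin_apply_mul_I`), so `Φ(ρ) - Φ(δ) = ∫∫ r Δu ≥ 0`; as `Φ(0) = 0` and
`Φ` is continuous, `Φ ≥ 0`.  Finally `∫ g(ρ, ·) - ∫ g(δ, ·) = ∫_δ^ρ Φ(r)/r dr ≥ 0`, and `δ → 0`
gives the claim by continuity of circle averages in the radius.

* `bilin_apply_add_bilin_apply_mul_I` — `B(w,w) + B(iw,iw) = |w|² (B(1,1) + B(i,i))` for every
  real bilinear `B` (rotation invariance of the trace);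
* `hasDerivAt_comp_circleMap_radius` — the radial chain rule (with the tree's
  `FanCrossing.hasDerivAt_circleMap_radius`, `AnnulusCrossing.continuous_circleMap_uncurry`);
* `integral_radialFlux_sub`, `integral_angular_eq_zero` — the two one-variable integrations;
* `intervalIntegral_swap_of_continuous_rect` — Fubini on a rectangle for continuous functions;
* `radialFlux_nonneg`, **`le_circleAverage_of_laplacian_nonneg`**, `circleAverage_mono_radius`,
  **`isSubharmonicOn_coe_of_laplacian_nonneg`**;
* `le_circleAverage_of_laplacian_nonneg_of_contDiffOn`,
  `isSubharmonicOn_coe_of_laplacian_nonneg_of_contDiffOn` — local forms (`u` of class `C²` on an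
  open `U ⊇ D̄(c, R)` only; cutoff by a `ContDiffBump`).

## References

* L. Hörmander, *An Introduction to Complex Analysis in Several Variables*, 2nd ed. (1973),
  Thm. 1.6.3 and the remark following it (a `C²` function is subharmonic iff `Δu ≥ 0`).
  [HormanderSCV1973]
* T. Ransford, *Potential Theory in the Complex Plane*, LMS Student Texts 28 (1995), Thm. 2.4.4
  (`u ∈ C²`: subharmonic iff `Δu ≥ 0`). [Ransford1995]
-/

noncomputable section

open scoped Topology Real
open MeasureTheory Filter Set Metric Complex intervalIntegral

namespace Literature.Analysis.Pluripotential

open Literature.Analysis.Complex.FanCrossing (hasDerivAt_circleMap_radius)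
open Literature.Analysis.Complex.AnnulusCrossing (continuous_circleMap_uncurry)

/-! ### Rotation invariance of the trace of a real bilinear form on `ℂ` -/

/-- For a real bilinear form `B` on `ℂ` and `w ∈ ℂ`:
`B(w, w) + B(wi, wi) = (Re w ² + Im w ²) (B(1,1) + B(i,i))` — the cross terms cancel, no symmetry
of `B` is needed. [folklore] -/
theorem bilin_apply_add_bilin_apply_mul_I (B : ℂ →L[ℝ] ℂ →L[ℝ] ℝ) (w : ℂ) :
    B w w + B (w * I) (w * I) = (w.re ^ 2 + w.im ^ 2) * (B 1 1 + B I I) := by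
  have key : ∀ x y : ℝ,
      B ((x : ℝ) • (1 : ℂ) + (y : ℝ) • I) ((x : ℝ) • (1 : ℂ) + (y : ℝ) • I) +
        B ((x : ℝ) • I + (-y : ℝ) • (1 : ℂ)) ((x : ℝ) • I + (-y : ℝ) • (1 : ℂ)) =
      (x ^ 2 + y ^ 2) * (B 1 1 + B I I) := by
    intro x y
    simp only [map_add, map_smul]
    simp [smul_eq_mul]
    ring
  have hw : w = (w.re : ℝ) • (1 : ℂ) + (w.im : ℝ) • I := by
    apply Complex.ext <;> simp
  have hwI : w * I = (w.re : ℝ) • I + (-w.im : ℝ) • (1 : ℂ) := by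
    apply Complex.ext <;> simp
  calc B w w + B (w * I) (w * I)
      = B ((w.re : ℝ) • (1 : ℂ) + (w.im : ℝ) • I) ((w.re : ℝ) • (1 : ℂ) + (w.im : ℝ) • I) +
          B ((w.re : ℝ) • I + (-w.im : ℝ) • (1 : ℂ)) ((w.re : ℝ) • I + (-w.im : ℝ) • (1 : ℂ)) := by
        rw [← hwI, ← hw]
    _ = (w.re ^ 2 + w.im ^ 2) * (B 1 1 + B I I) := key w.re w.im

/-! ### Radial derivatives along `r ↦ c + r e^{iθ}` -/

/-- Radial chain rule: `d/dr u(c + r e^{iθ}) = Du_{c + re^{iθ}}(e^{iθ})` for `u` differentiable.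
[folklore] -/
theorem hasDerivAt_comp_circleMap_radius {F : Type*} [NormedAddCommGroup F] [NormedSpace ℝ F]
    {u : ℂ → F} (hu : Differentiable ℝ u) (c : ℂ) (θ r : ℝ) :
    HasDerivAt (fun s : ℝ => u (circleMap c s θ)) (fderiv ℝ u (circleMap c r θ) (cexp (θ * I))) r :=
  (hu _).hasFDerivAt.comp_hasDerivAt r (hasDerivAt_circleMap_radius c θ r)

/-- `circleMap 0 r θ = r e^{iθ}` as a real multiple of the unit vector. [folklore] -/
theorem circleMap_zero_eq_smul (r θ : ℝ) : circleMap 0 r θ = (r : ℝ) • cexp (θ * I) := by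
  simp [circleMap, Complex.real_smul]

section Calculus

variable {u : ℂ → ℝ} (hu : ContDiff ℝ 2 u)
include hu

/-- A `C²` function is differentiable. [folklore] -/
private theorem differentiable_u : Differentiable ℝ u := hu.differentiable (by norm_num)

/-- The derivative of a `C²` function is differentiable. [folklore] -/
private theorem differentiable_fderiv_u : Differentiable ℝ (fderiv ℝ u) :=
  (hu.fderiv_right (m := 1) (by norm_num)).differentiable (by norm_num)

/-- The derivative of a `C²` function is continuous. [folklore] -/
private theorem continuous_fderiv_u : Continuous (fderiv ℝ u) :=
  hu.continuous_fderiv (by norm_num)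

/-- The second derivative of a `C²` function is continuous. [folklore] -/
private theorem continuous_fderiv_fderiv_u : Continuous (fderiv ℝ (fderiv ℝ u)) :=
  (hu.fderiv_right (m := 1) (by norm_num)).continuous_fderiv (by norm_num)

/-- **Radial integration.**  With `e = e^{iθ}`, `P(r) = Du_{c+re}(r e)` satisfies
`P' = Du(e) + r D²u(e, e)`, so `∫_δ^ρ (Du(e) + r D²u(e,e)) dr = P(ρ) - P(δ)`.
[cite: HormanderSCV1973, Thm. 1.6.3] -/
theorem integral_radialFlux_sub (c : ℂ) (θ δ ρ : ℝ) :
    ∫ r in δ..ρ, (fderiv ℝ u (circleMap c r θ) (cexp (θ * I)) +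
        r * fderiv ℝ (fderiv ℝ u) (circleMap c r θ) (cexp (θ * I)) (cexp (θ * I))) =
      fderiv ℝ u (circleMap c ρ θ) (circleMap 0 ρ θ) -
        fderiv ℝ u (circleMap c δ θ) (circleMap 0 δ θ) := by
  set e : ℂ := cexp (θ * I) with he
  have hderiv : ∀ r : ℝ, HasDerivAt (fun s : ℝ => fderiv ℝ u (circleMap c s θ) (circleMap 0 s θ))
      (fderiv ℝ u (circleMap c r θ) e +
        r * fderiv ℝ (fderiv ℝ u) (circleMap c r θ) e e) r := by
    intro r
    have h1 : HasDerivAt (fun s : ℝ => fderiv ℝ u (circleMap c s θ))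
        (fderiv ℝ (fderiv ℝ u) (circleMap c r θ) e) r :=
      (differentiable_fderiv_u hu _).hasFDerivAt.comp_hasDerivAt r
        (hasDerivAt_circleMap_radius c θ r)
    have h2 : HasDerivAt (fun s : ℝ => circleMap 0 s θ) e r := by
      simpa using hasDerivAt_circleMap_radius 0 θ r
    have h3 := h1.clm_apply h2
    have hval : fderiv ℝ (fderiv ℝ u) (circleMap c r θ) e (circleMap 0 r θ) +
        fderiv ℝ u (circleMap c r θ) e =
        fderiv ℝ u (circleMap c r θ) e + r * fderiv ℝ (fderiv ℝ u) (circleMap c r θ) e e := by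
      rw [circleMap_zero_eq_smul, map_smul, smul_eq_mul, add_comm]
    rw [hval] at h3
    exact h3
  have hcont : Continuous fun r : ℝ => fderiv ℝ u (circleMap c r θ) e +
      r * fderiv ℝ (fderiv ℝ u) (circleMap c r θ) e e := by
    have hc1 : Continuous fun r : ℝ => circleMap c r θ :=
      (continuous_circleMap_uncurry c).comp (Continuous.prodMk_left θ)
    exact ((continuous_fderiv_u hu).comp hc1).clm_apply continuous_const |>.add
      (continuous_id.mul
        ((((continuous_fderiv_fderiv_u hu).comp hc1).clm_apply continuous_const).clm_apply
          continuous_const))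
  exact integral_eq_sub_of_hasDerivAt (fun r _ => hderiv r) (hcont.intervalIntegrable _ _)

/-- **Angular integration.**  With `q = c + r e^{iθ}`, `w = r e^{iθ}`:
`d/dθ Du_q(w i) = D²u_q(w i, w i) - Du_q(w)`, and by periodicity
`∫₀^{2π} (D²u_q(wi, wi) - Du_q(w)) dθ = 0`. [cite: HormanderSCV1973, Thm. 1.6.3] -/
theorem integral_angular_eq_zero (c : ℂ) (r : ℝ) :
    ∫ θ in (0 : ℝ)..2 * π, (fderiv ℝ (fderiv ℝ u) (circleMap c r θ) (circleMap 0 r θ * I)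
        (circleMap 0 r θ * I) - fderiv ℝ u (circleMap c r θ) (circleMap 0 r θ)) = 0 := by
  have hderiv : ∀ θ : ℝ, HasDerivAt (fun t : ℝ => fderiv ℝ u (circleMap c r t) (circleMap 0 r t * I))
      (fderiv ℝ (fderiv ℝ u) (circleMap c r θ) (circleMap 0 r θ * I) (circleMap 0 r θ * I) -
        fderiv ℝ u (circleMap c r θ) (circleMap 0 r θ)) θ := by
    intro θ
    have h1 : HasDerivAt (fun t : ℝ => fderiv ℝ u (circleMap c r t))
        (fderiv ℝ (fderiv ℝ u) (circleMap c r θ) (circleMap 0 r θ * I)) θ :=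
      (differentiable_fderiv_u hu _).hasFDerivAt.comp_hasDerivAt θ (hasDerivAt_circleMap c r θ)
    have h2 : HasDerivAt (fun t : ℝ => circleMap 0 r t * I) (circleMap 0 r θ * I * I) θ :=
      (hasDerivAt_circleMap 0 r θ).mul_const I
    have h3 := h1.clm_apply h2
    have hval : fderiv ℝ (fderiv ℝ u) (circleMap c r θ) (circleMap 0 r θ * I) (circleMap 0 r θ * I) +
        fderiv ℝ u (circleMap c r θ) (circleMap 0 r θ * I * I) =
        fderiv ℝ (fderiv ℝ u) (circleMap c r θ) (circleMap 0 r θ * I) (circleMap 0 r θ * I) -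
          fderiv ℝ u (circleMap c r θ) (circleMap 0 r θ) := by
      rw [mul_assoc, Complex.I_mul_I, mul_neg_one, map_neg, sub_eq_add_neg]
    rw [hval] at h3
    exact h3
  have hcont : Continuous fun θ : ℝ =>
      fderiv ℝ (fderiv ℝ u) (circleMap c r θ) (circleMap 0 r θ * I) (circleMap 0 r θ * I) -
        fderiv ℝ u (circleMap c r θ) (circleMap 0 r θ) := by
    have hc1 : Continuous fun θ : ℝ => circleMap c r θ := continuous_circleMap c r
    have hc0 : Continuous fun θ : ℝ => circleMap 0 r θ * I := (continuous_circleMap 0 r).mul continuous_const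
    exact ((((continuous_fderiv_fderiv_u hu).comp hc1).clm_apply hc0).clm_apply hc0).sub
      (((continuous_fderiv_u hu).comp hc1).clm_apply (continuous_circleMap 0 r))
  rw [integral_eq_sub_of_hasDerivAt (fun θ _ => hderiv θ) (hcont.intervalIntegrable _ _)]
  have hp1 : circleMap c r (2 * π) = circleMap c r 0 := by
    simpa using periodic_circleMap c r 0
  have hp0 : circleMap 0 r (2 * π) = circleMap 0 r 0 := by
    simpa using periodic_circleMap 0 r 0
  rw [hp1, hp0, sub_self]

end Calculus

/-! ### Fubini on a rectangle for continuous functions -/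

/-- Fubini for a continuous function on `[a, b] × [a', b']`, in interval-integral form.
[folklore] -/
theorem intervalIntegral_swap_of_continuous_rect {f : ℝ → ℝ → ℝ}
    (hf : Continuous (Function.uncurry f)) {a b a' b' : ℝ} (hab : a ≤ b) (hab' : a' ≤ b') :
    ∫ x in a..b, ∫ y in a'..b', f x y = ∫ y in a'..b', ∫ x in a..b, f x y := by
  have hint : Integrable (Function.uncurry f)
      ((volume.restrict (Ioc a b)).prod (volume.restrict (Ioc a' b'))) := by
    rw [Measure.prod_restrict, ← Measure.volume_eq_prod]
    exact (hf.continuousOn.integrableOn_compact (isCompact_Icc.prod isCompact_Icc)).mono_set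
      (prod_mono Ioc_subset_Icc_self Ioc_subset_Icc_self)
  have h := integral_integral_swap hint
  simp only [integral_of_le hab, integral_of_le hab']
  exact h

/-! ### Monotonicity of the radial flux and of circle means -/

section Main

variable {u : ℂ → ℝ} (hu : ContDiff ℝ 2 u) {c : ℂ} {R : ℝ}
  (hΔ : ∀ z ∈ closedBall c R,
    0 ≤ fderiv ℝ (fderiv ℝ u) z 1 1 + fderiv ℝ (fderiv ℝ u) z I I)
include hu

/-- The radial flux `Φ(r) = ∫₀^{2π} Du_{c + re^{iθ}}(r e^{iθ}) dθ` is continuous in `r`.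
[folklore] -/
theorem continuous_radialFlux :
    Continuous fun r : ℝ => ∫ θ in (0 : ℝ)..2 * π,
      fderiv ℝ u (circleMap c r θ) (circleMap 0 r θ) := by
  apply intervalIntegral.continuous_parametric_intervalIntegral_of_continuous'
  have hq : Continuous fun p : ℝ × ℝ => circleMap c p.1 p.2 := continuous_circleMap_uncurry c
  have hw : Continuous fun p : ℝ × ℝ => circleMap 0 p.1 p.2 := continuous_circleMap_uncurry 0
  exact ((continuous_fderiv_u hu).comp hq).clm_apply hw

include hΔ

/-- **The radial flux is non-decreasing** on `(0, R]` when `Δu ≥ 0` on `D̄(c, R)`: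
`Φ(r) - Φ(δ) = ∫₀^{2π} ∫_δ^r s Δu(c + s e^{iθ}) ds dθ ≥ 0` (radial and angular integrations,
`integral_radialFlux_sub`, `integral_angular_eq_zero`, Fubini, and rotation invariance of `Δ`).
[cite: HormanderSCV1973, Thm. 1.6.3] -/
theorem radialFlux_mono {δ r : ℝ} (hδ : 0 < δ) (hδr : δ ≤ r) (hrR : r ≤ R) :
    ∫ θ in (0 : ℝ)..2 * π, fderiv ℝ u (circleMap c δ θ) (circleMap 0 δ θ) ≤
      ∫ θ in (0 : ℝ)..2 * π, fderiv ℝ u (circleMap c r θ) (circleMap 0 r θ) := by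
  have hDc : Continuous (fderiv ℝ u) := continuous_fderiv_u hu
  have hHc : Continuous (fderiv ℝ (fderiv ℝ u)) := continuous_fderiv_fderiv_u hu
  have h2π : (0 : ℝ) ≤ 2 * π := by positivity
  -- the two integrands on the rectangle `θ ∈ [0, 2π]`, `s ∈ [δ, r]`
  set F₁ : ℝ → ℝ → ℝ := fun θ s => fderiv ℝ u (circleMap c s θ) (cexp (θ * I)) +
      s * fderiv ℝ (fderiv ℝ u) (circleMap c s θ) (cexp (θ * I)) (cexp (θ * I)) with hF₁
  set F₂ : ℝ → ℝ → ℝ := fun θ s =>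
      s * fderiv ℝ (fderiv ℝ u) (circleMap c s θ) (cexp (θ * I) * I) (cexp (θ * I) * I) -
        fderiv ℝ u (circleMap c s θ) (cexp (θ * I)) with hF₂
  have hq : Continuous fun p : ℝ × ℝ => circleMap c p.2 p.1 :=
    (continuous_circleMap_uncurry c).comp continuous_swap
  have he : Continuous fun p : ℝ × ℝ => cexp (p.1 * I) := by fun_prop
  have heI : Continuous fun p : ℝ × ℝ => cexp (p.1 * I) * I := he.mul continuous_const
  have hF₁c : Continuous (Function.uncurry F₁) :=
    ((hDc.comp hq).clm_apply he).add
      (continuous_snd.mul (((hHc.comp hq).clm_apply he).clm_apply he))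
  have hF₂c : Continuous (Function.uncurry F₂) :=
    (continuous_snd.mul (((hHc.comp hq).clm_apply heI).clm_apply heI)).sub
      ((hDc.comp hq).clm_apply he)
  have hΦc : ∀ ρ : ℝ, Continuous fun θ : ℝ => fderiv ℝ u (circleMap c ρ θ) (circleMap 0 ρ θ) :=
    fun ρ => (hDc.comp (continuous_circleMap c ρ)).clm_apply (continuous_circleMap 0 ρ)
  -- (1) `Φ r - Φ δ = ∫θ ∫s F₁`
  have h1 : (∫ θ in (0 : ℝ)..2 * π, fderiv ℝ u (circleMap c r θ) (circleMap 0 r θ)) -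
      ∫ θ in (0 : ℝ)..2 * π, fderiv ℝ u (circleMap c δ θ) (circleMap 0 δ θ) =
      ∫ θ in (0 : ℝ)..2 * π, ∫ s in δ..r, F₁ θ s := by
    rw [← intervalIntegral.integral_sub ((hΦc r).intervalIntegrable _ _)
      ((hΦc δ).intervalIntegrable _ _)]
    refine intervalIntegral.integral_congr fun θ _ => ?_
    exact (integral_radialFlux_sub hu c θ δ r).symm
  -- (2) `∫θ ∫s F₂ = 0`
  have h2 : ∫ θ in (0 : ℝ)..2 * π, ∫ s in δ..r, F₂ θ s = 0 := by
    rw [intervalIntegral_swap_of_continuous_rect hF₂c h2π hδr]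
    have hzero : EqOn (fun s => ∫ θ in (0 : ℝ)..2 * π, F₂ θ s) (fun _ => 0) (uIcc δ r) := by
      intro s hs
      rw [uIcc_of_le hδr] at hs
      have hs0 : s ≠ 0 := (hδ.trans_le hs.1).ne'
      have hpt : ∀ θ : ℝ,
          fderiv ℝ (fderiv ℝ u) (circleMap c s θ) (circleMap 0 s θ * I) (circleMap 0 s θ * I) -
            fderiv ℝ u (circleMap c s θ) (circleMap 0 s θ) = s * F₂ θ s := by
        intro θ
        simp only [hF₂, circleMap_zero_eq_smul, smul_mul_assoc, map_smul, smul_apply, smul_eq_mul]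
        ring
      have hmul : s * ∫ θ in (0 : ℝ)..2 * π, F₂ θ s = 0 := by
        have hc : ∫ θ in (0 : ℝ)..2 * π, s * F₂ θ s = ∫ θ in (0 : ℝ)..2 * π,
            (fderiv ℝ (fderiv ℝ u) (circleMap c s θ) (circleMap 0 s θ * I) (circleMap 0 s θ * I) -
              fderiv ℝ u (circleMap c s θ) (circleMap 0 s θ)) :=
          intervalIntegral.integral_congr fun θ _ => (hpt θ).symm
        rw [← intervalIntegral.integral_const_mul, hc, integral_angular_eq_zero hu c s]
      exact (mul_eq_zero.1 hmul).resolve_left hs0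
    rw [intervalIntegral.integral_congr hzero]
    simp
  -- (3) `F₁ + F₂ = s Δu ≥ 0` on the rectangle
  have hsum : ∀ θ s : ℝ, F₁ θ s + F₂ θ s =
      s * (fderiv ℝ (fderiv ℝ u) (circleMap c s θ) 1 1 +
        fderiv ℝ (fderiv ℝ u) (circleMap c s θ) I I) := by
    intro θ s
    have hb := bilin_apply_add_bilin_apply_mul_I (fderiv ℝ (fderiv ℝ u) (circleMap c s θ))
      (cexp (θ * I))
    have hnorm : (cexp (θ * I)).re ^ 2 + (cexp (θ * I)).im ^ 2 = 1 := by
      rw [Complex.exp_ofReal_mul_I_re, Complex.exp_ofReal_mul_I_im]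
      nlinarith [Real.cos_sq_add_sin_sq θ]
    rw [hnorm, one_mul] at hb
    simp only [hF₁, hF₂]
    rw [← hb]
    ring
  have hnonneg : 0 ≤ ∫ θ in (0 : ℝ)..2 * π, ∫ s in δ..r, (F₁ θ s + F₂ θ s) := by
    refine intervalIntegral.integral_nonneg h2π fun θ _ => ?_
    refine intervalIntegral.integral_nonneg hδr fun s hs => ?_
    rw [hsum]
    have hs0 : 0 ≤ s := hδ.le.trans hs.1
    have hmem : circleMap c s θ ∈ closedBall c R :=
      closedBall_subset_closedBall (hs.2.trans hrR)
        (sphere_subset_closedBall (circleMap_mem_sphere c hs0 θ))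
    exact mul_nonneg hs0 (hΔ _ hmem)
  -- (4) combine
  have hI₁ : ∀ θ : ℝ, IntervalIntegrable (fun s => F₁ θ s) volume δ r := fun θ =>
    (hF₁c.comp (Continuous.prodMk_right θ)).intervalIntegrable _ _
  have hI₂ : ∀ θ : ℝ, IntervalIntegrable (fun s => F₂ θ s) volume δ r := fun θ =>
    (hF₂c.comp (Continuous.prodMk_right θ)).intervalIntegrable _ _
  have h12 : ∫ θ in (0 : ℝ)..2 * π, ∫ s in δ..r, (F₁ θ s + F₂ θ s) =
      (∫ θ in (0 : ℝ)..2 * π, ∫ s in δ..r, F₁ θ s) +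
        ∫ θ in (0 : ℝ)..2 * π, ∫ s in δ..r, F₂ θ s := by
    rw [← intervalIntegral.integral_add
      ((intervalIntegral.continuous_parametric_intervalIntegral_of_continuous' hF₁c δ r
        ).intervalIntegrable _ _)
      ((intervalIntegral.continuous_parametric_intervalIntegral_of_continuous' hF₂c δ r
        ).intervalIntegrable _ _)]
    refine intervalIntegral.integral_congr fun θ _ => ?_
    exact intervalIntegral.integral_add (hI₁ θ) (hI₂ θ)
  linarith [h1, h2, h12, hnonneg]

/-- **The radial flux is non-negative**: `Φ(r) ≥ 0` for `0 < r ≤ R` (`Φ` is continuous with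
`Φ(0) = 0` and non-decreasing on `(0, R]`). [cite: HormanderSCV1973, Thm. 1.6.3] -/
theorem radialFlux_nonneg {r : ℝ} (hr : 0 < r) (hrR : r ≤ R) :
    0 ≤ ∫ θ in (0 : ℝ)..2 * π, fderiv ℝ u (circleMap c r θ) (circleMap 0 r θ) := by
  set Φ : ℝ → ℝ := fun ρ => ∫ θ in (0 : ℝ)..2 * π,
    fderiv ℝ u (circleMap c ρ θ) (circleMap 0 ρ θ) with hΦ
  have hΦc : Continuous Φ := continuous_radialFlux hu
  have hΦ0 : Φ 0 = 0 := by
    simp [hΦ, circleMap_zero_radius]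
  have hT : Tendsto Φ (𝓝[>] 0) (𝓝 0) := by
    have h := (hΦc.continuousAt (x := 0)).tendsto.mono_left (nhdsWithin_le_nhds (s := Ioi 0))
    rwa [hΦ0] at h
  have hev : ∀ᶠ δ in 𝓝[>] (0 : ℝ), Φ δ ≤ Φ r := by
    filter_upwards [Ioo_mem_nhdsGT hr] with δ hδ
    exact radialFlux_mono hu hΔ hδ.1 hδ.2.le hrR
  exact le_of_tendsto hT hev

/-- **Circle integrals are non-decreasing in the radius** on `(0, R]` when `Δu ≥ 0` on
`D̄(c, R)`: `∫₀^{2π} u(c + ρe^{iθ}) dθ - ∫₀^{2π} u(c + δe^{iθ}) dθ = ∫_δ^ρ Φ(s)/s ds ≥ 0`.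
[cite: HormanderSCV1973, Thm. 1.6.3] -/
theorem integral_circleMap_mono {δ ρ : ℝ} (hδ : 0 < δ) (hδρ : δ ≤ ρ) (hρR : ρ ≤ R) :
    ∫ θ in (0 : ℝ)..2 * π, u (circleMap c δ θ) ≤ ∫ θ in (0 : ℝ)..2 * π, u (circleMap c ρ θ) := by
  have hDc : Continuous (fderiv ℝ u) := continuous_fderiv_u hu
  have h2π : (0 : ℝ) ≤ 2 * π := by positivity
  set G : ℝ → ℝ → ℝ := fun θ s => fderiv ℝ u (circleMap c s θ) (cexp (θ * I)) with hG
  have hq : Continuous fun p : ℝ × ℝ => circleMap c p.2 p.1 :=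
    (continuous_circleMap_uncurry c).comp continuous_swap
  have he : Continuous fun p : ℝ × ℝ => cexp (p.1 * I) := by fun_prop
  have hGc : Continuous (Function.uncurry G) := (hDc.comp hq).clm_apply he
  have huc : ∀ ρ' : ℝ, Continuous fun θ : ℝ => u (circleMap c ρ' θ) := fun ρ' =>
    hu.continuous.comp (continuous_circleMap c ρ')
  -- FTC along rays, then Fubini
  have h1 : (∫ θ in (0 : ℝ)..2 * π, u (circleMap c ρ θ)) - ∫ θ in (0 : ℝ)..2 * π, u (circleMap c δ θ) =
      ∫ s in δ..ρ, ∫ θ in (0 : ℝ)..2 * π, G θ s := by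
    rw [← intervalIntegral.integral_sub ((huc ρ).intervalIntegrable _ _)
      ((huc δ).intervalIntegrable _ _), ← intervalIntegral_swap_of_continuous_rect hGc h2π hδρ]
    refine intervalIntegral.integral_congr fun θ _ => ?_
    have hcont : Continuous fun s : ℝ => G θ s := hGc.comp (Continuous.prodMk_right θ)
    exact (integral_eq_sub_of_hasDerivAt
      (fun s _ => hasDerivAt_comp_circleMap_radius (differentiable_u hu) c θ s)
      (hcont.intervalIntegrable _ _)).symm
  -- the inner integral is `Φ(s)/s ≥ 0`
  have h2 : 0 ≤ ∫ s in δ..ρ, ∫ θ in (0 : ℝ)..2 * π, G θ s := by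
    refine intervalIntegral.integral_nonneg hδρ fun s hs => ?_
    have hs0 : 0 < s := hδ.trans_le hs.1
    have hΦ := radialFlux_nonneg hu hΔ hs0 (hs.2.trans hρR)
    have hmul : s * ∫ θ in (0 : ℝ)..2 * π, G θ s =
        ∫ θ in (0 : ℝ)..2 * π, fderiv ℝ u (circleMap c s θ) (circleMap 0 s θ) := by
      rw [← intervalIntegral.integral_const_mul]
      refine intervalIntegral.integral_congr fun θ _ => ?_
      simp only [hG, circleMap_zero_eq_smul, map_smul, smul_eq_mul]
    rw [← hmul] at hΦ
    exact (mul_nonneg_iff_of_pos_left hs0).1 hΦ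
  linarith [h1, h2]

/-- **Circle averages are non-decreasing in the radius** on `(0, R]` when `Δu ≥ 0` on
`D̄(c, R)`. [cite: HormanderSCV1973, Thm. 1.6.3] -/
theorem circleAverage_mono_radius {δ ρ : ℝ} (hδ : 0 < δ) (hδρ : δ ≤ ρ) (hρR : ρ ≤ R) :
    Real.circleAverage u c δ ≤ Real.circleAverage u c ρ := by
  simp only [Real.circleAverage, smul_eq_mul]
  exact mul_le_mul_of_nonneg_left (integral_circleMap_mono hu hΔ hδ hδρ hρR)
    (inv_nonneg.2 (by positivity))

/-- **A `C²` function with `Δu ≥ 0` on a closed disc satisfies the sub-mean-value inequality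
there** (Hörmander (1973), Thm. 1.6.3, smooth case, the direction `Δu ≥ 0 ⇒` subharmonic): for
`u ∈ C²(ℂ)` with `D²u(z)(1,1) + D²u(z)(i,i) ≥ 0` on `D̄(c, R)` and `0 < ρ ≤ R`,
`u(c) ≤ (2π)⁻¹ ∫₀^{2π} u(c + ρ e^{iθ}) dθ`. [cite: HormanderSCV1973, Thm. 1.6.3]
[cite: Ransford1995, Thm. 2.4.4] -/
theorem le_circleAverage_of_laplacian_nonneg {ρ : ℝ} (hρ : 0 < ρ) (hρR : ρ ≤ R) :
    u c ≤ Real.circleAverage u c ρ := by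
  have hT : Tendsto (Real.circleAverage u c) (𝓝[>] 0) (𝓝 (u c)) := by
    have h := ((Real.Continuous.circleAverage (c := c) hu.continuous).continuousAt
      (x := 0)).tendsto.mono_left (nhdsWithin_le_nhds (s := Ioi 0))
    rwa [Real.circleAverage_zero] at h
  have hev : ∀ᶠ δ in 𝓝[>] (0 : ℝ), Real.circleAverage u c δ ≤ Real.circleAverage u c ρ := by
    filter_upwards [Ioo_mem_nhdsGT hρ] with δ hδ
    exact circleAverage_mono_radius hu hΔ hδ.1 hδ.2.le hρR
  exact le_of_tendsto hT hev

end Main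

/-! ### Packaging: `C²` functions with `Δu ≥ 0` are subharmonic in the tree's sense -/

/-- **`Δu ≥ 0 ⇒ u` subharmonic** (Hörmander (1973), Thm. 1.6.3, smooth case): a `C²` function
`u : ℂ → ℝ` whose Laplacian `D²u(z)(1,1) + D²u(z)(i,i)` is non-negative on `U` is subharmonic
on `U` as an `[-∞, +∞)`-valued function (`IsSubharmonicOn`: upper semicontinuous, `< ⊤`, and
the sub-mean-value inequality over every closed disc in `U`).  The converse smooth-case
statement is `levi_nonneg_of_frequently_le_circleAverage` (`LeviForm.lean`).
[cite: HormanderSCV1973, Thm. 1.6.3] -/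
theorem isSubharmonicOn_coe_of_laplacian_nonneg {u : ℂ → ℝ} (hu : ContDiff ℝ 2 u) {U : Set ℂ}
    (hΔ : ∀ z ∈ U, 0 ≤ fderiv ℝ (fderiv ℝ u) z 1 1 + fderiv ℝ (fderiv ℝ u) z I I) :
    IsSubharmonicOn (fun z => ((u z : ℝ) : EReal)) U := by
  refine ⟨upperSemicontinuousOn_of_continuousOn
      (continuous_coe_real_ereal.comp_continuousOn hu.continuous.continuousOn),
    fun z _ => EReal.coe_lt_top _, fun c R hR hcl => ?_⟩
  rw [circleMean_coe_eq_circleAverage u c R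
    (hu.continuous.continuousOn.circleIntegrable')]
  exact EReal.coe_le_coe_iff.2
    (le_circleAverage_of_laplacian_nonneg hu (fun z hz => hΔ z (hcl hz)) hR le_rfl)

/-! ### Localisation: functions `C²` only on a neighbourhood of the closed disc -/

/-- **Local form** of `le_circleAverage_of_laplacian_nonneg`: it suffices that `u` be `C²` on an
open set `U ⊇ D̄(c, R)` (multiply by a smooth bump which is `1` near `D̄(c, R)` and supported in
`U`; the product is `C²` on `ℂ`, agrees with `u` near `D̄(c, R)`, hence has the same Laplacian
and the same circle averages there). [cite: HormanderSCV1973, Thm. 1.6.3] -/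
theorem le_circleAverage_of_laplacian_nonneg_of_contDiffOn {u : ℂ → ℝ} {U : Set ℂ}
    (hU : IsOpen U) (hu : ContDiffOn ℝ 2 u U) {c : ℂ} {R : ℝ} (hcR : closedBall c R ⊆ U)
    (hΔ : ∀ z ∈ closedBall c R,
      0 ≤ fderiv ℝ (fderiv ℝ u) z 1 1 + fderiv ℝ (fderiv ℝ u) z I I)
    {ρ : ℝ} (hρ : 0 < ρ) (hρR : ρ ≤ R) : u c ≤ Real.circleAverage u c ρ := by
  have hR : 0 ≤ R := hρ.le.trans hρR
  -- room: `closedBall c (R + δ) ⊆ U`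
  obtain ⟨δ, hδ, hδU⟩ := (isCompact_closedBall c R).exists_cthickening_subset_open hU hcR
  rw [cthickening_closedBall hδ.le hR] at hδU
  -- a smooth bump `= 1` on `closedBall c (R + δ/2)`, supported in `ball c (R + δ)`
  let f : ContDiffBump c := ⟨R + δ / 2, R + δ, by positivity, by linarith⟩
  set v : ℂ → ℝ := fun x => f x * u x with hv
  -- `v = u` near the closed disc
  have hvu : ∀ z ∈ closedBall c R, v =ᶠ[𝓝 z] u := by
    intro z hz
    have hzin : ball z (δ / 2) ⊆ closedBall c (R + δ / 2) := by
      intro x hx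
      rw [mem_ball] at hx
      rw [mem_closedBall] at hz ⊢
      linarith [dist_triangle x z c]
    filter_upwards [ball_mem_nhds z (by positivity : (0 : ℝ) < δ / 2)] with x hx
    simp only [hv, f.one_of_mem_closedBall (hzin hx), one_mul]
  -- `v` is `C²` on `ℂ`
  have hvC : ContDiff ℝ 2 v := by
    rw [contDiff_iff_contDiffAt]
    intro x
    by_cases hx : x ∈ U
    · exact (f.contDiff.contDiffAt).mul (hu.contDiffAt (hU.mem_nhds hx))
    · -- off `U` the point is outside `closedBall c (δ + R)`, where `v = 0` nearby
      have hxout : x ∉ closedBall c (δ + R) := fun h => hx (hδU h)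
      have hopen : IsOpen (closedBall c (δ + R))ᶜ := isClosed_closedBall.isOpen_compl
      have hzero : v =ᶠ[𝓝 x] fun _ => 0 := by
        filter_upwards [hopen.mem_nhds hxout] with y hy
        have hy' : f.rOut ≤ dist y c := by
          rw [mem_compl_iff, mem_closedBall, not_le] at hy
          show R + δ ≤ dist y c
          linarith
        simp only [hv, f.zero_of_le_dist hy', zero_mul]
      exact (contDiffAt_const (c := (0 : ℝ))).congr_of_eventuallyEq hzero
  -- same Laplacian on the closed disc
  have hΔv : ∀ z ∈ closedBall c R,
      0 ≤ fderiv ℝ (fderiv ℝ v) z 1 1 + fderiv ℝ (fderiv ℝ v) z I I := by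
    intro z hz
    have h2 : fderiv ℝ (fderiv ℝ v) z = fderiv ℝ (fderiv ℝ u) z :=
      ((hvu z hz).fderiv).fderiv_eq
    rw [h2]
    exact hΔ z hz
  -- apply the global statement to `v` and transfer back
  have hmain := le_circleAverage_of_laplacian_nonneg hvC hΔv hρ hρR
  have hvc : v c = u c := (hvu c (mem_closedBall_self hR)).self_of_nhds
  have havg : Real.circleAverage v c ρ = Real.circleAverage u c ρ := by
    refine Real.circleAverage_congr_sphere fun x hx => ?_
    have hx' : x ∈ closedBall c R := by
      rw [abs_of_pos hρ] at hx
      exact closedBall_subset_closedBall hρR (sphere_subset_closedBall hx)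
    exact (hvu x hx').self_of_nhds
  rwa [hvc, havg] at hmain

/-- **Local form** of `isSubharmonicOn_coe_of_laplacian_nonneg`: a function `C²` on an open
set `U` with `Δu ≥ 0` there is subharmonic on `U`. [cite: HormanderSCV1973, Thm. 1.6.3] -/
theorem isSubharmonicOn_coe_of_laplacian_nonneg_of_contDiffOn {u : ℂ → ℝ} {U : Set ℂ}
    (hU : IsOpen U) (hu : ContDiffOn ℝ 2 u U)
    (hΔ : ∀ z ∈ U, 0 ≤ fderiv ℝ (fderiv ℝ u) z 1 1 + fderiv ℝ (fderiv ℝ u) z I I) :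
    IsSubharmonicOn (fun z => ((u z : ℝ) : EReal)) U := by
  refine ⟨upperSemicontinuousOn_of_continuousOn
      (continuous_coe_real_ereal.comp_continuousOn hu.continuousOn),
    fun z _ => EReal.coe_lt_top _, fun c R hR hcl => ?_⟩
  have hsph : sphere c |R| ⊆ U := by
    rw [abs_of_pos hR]
    exact sphere_subset_closedBall.trans hcl
  rw [circleMean_coe_eq_circleAverage u c R ((hu.continuousOn.mono hsph).circleIntegrable')]
  exact EReal.coe_le_coe_iff.2 (le_circleAverage_of_laplacian_nonneg_of_contDiffOn hU hu hcl
    (fun z hz => hΔ z (hcl hz)) hR le_rfl)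

end Literature.Analysis.Pluripotential
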